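import Mathlib
import HarnessLib

/-!
# Pseudospectra of a bounded operator: the three equivalent definitions

Topic `Literature/Analysis/OperatorTheory`. Source: L. N. Trefethen, M. Embree, *Spectra and
Pseudospectra* (Princeton 2005), §2 (matrices: definitions (2.1), (2.3), (2.6), Theorem 2.1, the
nesting (2.4)–(2.5), Theorem 2.2 (2.16)) and §4 (closed operators on a Banach space: Theorem 4.1,
the three definitions (4.3)–(4.5), Theorem 4.3), here for a BOUNDED operator `T : X →L[ℂ] X` on a
complex Banach space `X` (so the domain questions of §4 are absent), in Mathlib's language
(`spectrum ℂ T`, `resolventSet ℂ T`, `resolvent T z = Ring.inverse (algebraMap ℂ _ z - T)`, which is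
the genuine inverse `(z - T)⁻¹` off the spectrum and the junk value `0` on it).

For `ε > 0` the `ε`-pseudospectrum of `T` is any of the three sets
* `pseudospectrum T ε`      — (4.3): `z ∈ σ(T)` or `ε⁻¹ < ‖(z - T)⁻¹‖` (the book writes
  `‖(z - T)⁻¹‖ = ∞` on `σ(T)`; we spell the disjunction out);
* `perturbedSpectra T ε`    — (4.4): `z ∈ σ(T + E)` for some bounded `E` with `‖E‖ < ε`;
* `pseudoeigenvalues T ε`   — (4.5): `z ∈ σ(T)` or `‖z u - T u‖ < ε ‖u‖` for some `u ≠ 0`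
  (an `ε`-pseudoeigenvector).

Proved here (everything below is a theorem of this file; there are no named facts):
* the Banach-algebra lemmas behind Theorem 4.1 / 4.2:
  `resolventSet_add_of_norm_resolvent_mul_norm_lt` (stability of bounded invertibility, shifted:
  `‖(z - a)⁻¹‖ ‖e‖ < 1 ⇒ z ∈ ρ(a + e)`),
  `resolventSet_of_norm_resolvent_mul_norm_sub_lt`, `one_le_norm_resolvent_mul_norm_sub` and
  `inv_infDist_le_norm_resolvent` (`‖(z - a)⁻¹‖ ≥ 1 / dist(z, σ(a))`, T–E p. 33), and
  `mem_spectrum_or_lt_norm_resolvent_of_mem_spectrum_add` ((4.4) ⇒ (4.3) in any Banach algebra);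
* THEOREM 2.1 / the first clause of THEOREM 4.3: for `ε > 0` the three sets coincide
  (`pseudospectrum_eq_perturbedSpectra`, `pseudospectrum_eq_pseudoeigenvalues`,
  `perturbedSpectra_eq_pseudoeigenvalues`); the step (4.5) ⇒ (4.4) is the rank-one perturbation
  `E = g(·) ‖u‖⁻¹ (z u - T u)` built from a Hahn–Banach functional `g` with `‖g‖ = 1`, `g u = ‖u‖`
  (T–E's proof of Thm. 2.1 for a general norm, footnote 3), the step (4.3) ⇒ (4.5) takes
  `u = (z - T)⁻¹ x` for an `x` nearly attaining the resolvent norm, and (4.4) ⇒ (4.3) is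
  Theorem 4.1;
* the properties listed in THEOREM 4.3 / (2.4), (2.5), (2.16): `σ(T) ⊆ σ_ε(T)`, monotonicity in
  `ε`,
  `⋂_{ε>0} σ_ε(T) = σ(T)`, openness, `σ(T) + Δ_ε ⊆ σ_ε(T)`, `σ_ε(T) + Δ_δ ⊆ σ_{ε+δ}(T)`, and
  non-emptiness (from `spectrum.nonempty`);
* the matrix form of definition (2.6): in finite dimension the clause `z ∈ σ(T)` of (4.5) is
  absorbed (`mem_pseudospectrum_iff_exists_pseudoeigenvector`), because a spectral value is an
  eigenvalue.

Related tree files (searched, not imported — nothing of theirs is used):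
`Literature.Analysis.OperatorTheory.PseudospectralEnclosure` (Davies Lemma 9.1.2 for an ELEMENT `b`
of the algebra, `‖b‖ ≤ ‖(μ - a)⁻¹‖ ‖(μ - a) b‖`, and spectrum enclosures from resolvent-norm bounds
via the maximum principle), `Literature.LinearAlgebra.Matrix.ResolventPerturbation` (the matrix `ℓ∞`
case of the one-sided inclusion (2.3) ⇒ (2.1) through characteristic-polynomial roots) and
`Literature.Analysis.Matrix.KreissMatrixTheorem` (resolvent bounds versus power bounds); none of
them defines the three sets or proves their equality for a bounded operator. Mathlib has no
pseudospectrum.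

NOT TYPED here: the `2`-norm characterisation `σ_ε(A) = {z : s_min(z - A) < ε}` ((2.9)–(2.10))
and the equality `σ_ε(T) = σ(T) + Δ_ε` for normal `T` ((2.17)); the maximum-principle clause of
Theorem 4.3
(every bounded component of `σ_ε` meets `σ`).
-/

noncomputable section

open scoped Pointwise

namespace Literature.Analysis.OperatorTheory.Pseudospectra

section BanachAlgebra

variable {A : Type*} [NormedRing A] [NormedAlgebra ℂ A]

/-- Off the spectrum Mathlib's `resolvent a z` is the inverse of the unit `z - a`.
[cite: TrefethenEmbree2005, §4 p. 32 (definition of the resolvent)] -/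
theorem resolvent_eq_units_inv {a : A} {z : ℂ} {u : Aˣ} (hu : (u : A) = algebraMap ℂ A z - a) :
    resolvent a z = (↑u⁻¹ : A) := by
  rw [resolvent, ← hu, Ring.inverse_unit]

/-- Shifting an element by a scalar shifts its spectrum: `z ∈ σ(a)` gives `z + d ∈ σ(a + d · 1)`.
[cite: TrefethenEmbree2005, Thm. 2.2 (proof of (2.16))] -/
theorem add_mem_spectrum_add_algebraMap {a : A} {z : ℂ} (hz : z ∈ spectrum ℂ a) (d : ℂ) :
    z + d ∈ spectrum ℂ (a + algebraMap ℂ A d) := by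
  rw [← spectrum.add_singleton_eq]
  exact Set.add_mem_add hz (Set.mem_singleton d)

variable [CompleteSpace A]

/-- **Stability of bounded invertibility, shifted** (Trefethen–Embree Theorem 4.1 applied to
`z - a`, as in Theorem 4.2): if `z ∈ ρ(a)` and `‖(z - a)⁻¹‖ · ‖e‖ < 1` then `z ∈ ρ(a + e)`, because
`z - (a + e) = (z - a)(1 - (z - a)⁻¹ e)` and the second factor is inverted by a Neumann series.
[cite: TrefethenEmbree2005, Thm. 4.1 and Thm. 4.2] -/
theorem resolventSet_add_of_norm_resolvent_mul_norm_lt {a e : A} {z : ℂ}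
    (hz : z ∈ resolventSet ℂ a) (h : ‖resolvent a z‖ * ‖e‖ < 1) :
    z ∈ resolventSet ℂ (a + e) := by
  rw [spectrum.mem_resolventSet_iff] at hz ⊢
  obtain ⟨u, hu⟩ := hz
  have hres : resolvent a z = (↑u⁻¹ : A) := resolvent_eq_units_inv hu
  have hlt : ‖(↑u⁻¹ : A) * e‖ < 1 := (norm_mul_le _ _).trans_lt (by rwa [← hres])
  have h1 : IsUnit (1 - (↑u⁻¹ : A) * e) := by
    rw [← Units.val_oneSub _ hlt]
    exact Units.isUnit _
  have heq : algebraMap ℂ A z - (a + e) = (u : A) * (1 - (↑u⁻¹ : A) * e) := by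
    rw [mul_sub, mul_one, ← mul_assoc, Units.mul_inv, one_mul, hu]
    abel
  rw [heq]
  exact (Units.isUnit u).mul h1

/-- **Scalar shifts** (the case `e = (z - w) · 1` of the previous lemma, written so that no
`‖1‖ = 1` hypothesis on the algebra is needed): if `z ∈ ρ(a)` and `‖(z - a)⁻¹‖ · |z - w| < 1`
then `w ∈ ρ(a)`. [cite: TrefethenEmbree2005, Thm. 4.2 (openness of the resolvent set)] -/
theorem resolventSet_of_norm_resolvent_mul_norm_sub_lt {a : A} {z w : ℂ}
    (hz : z ∈ resolventSet ℂ a) (h : ‖resolvent a z‖ * ‖z - w‖ < 1) :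
    w ∈ resolventSet ℂ a := by
  rw [spectrum.mem_resolventSet_iff] at hz ⊢
  obtain ⟨u, hu⟩ := hz
  have hres : resolvent a z = (↑u⁻¹ : A) := resolvent_eq_units_inv hu
  have hlt : ‖(z - w) • (↑u⁻¹ : A)‖ < 1 := by
    rw [norm_smul, mul_comm, ← hres]
    exact h
  have h1 : IsUnit (1 - (z - w) • (↑u⁻¹ : A)) := by
    rw [← Units.val_oneSub _ hlt]
    exact Units.isUnit _
  have heq : algebraMap ℂ A w - a = (u : A) * (1 - (z - w) • (↑u⁻¹ : A)) := by
    rw [mul_sub, mul_one, mul_smul_comm, Units.mul_inv, hu, ← Algebra.algebraMap_eq_smul_one,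
      map_sub]
    abel
  rw [heq]
  exact (Units.isUnit u).mul h1

/-- **(4.4) ⇒ (4.3) in any complex Banach algebra**: if `‖e‖ < ε` and `z ∈ σ(a + e)`, then
`z ∈ σ(a)` or `ε⁻¹ < ‖(z - a)⁻¹‖` (contrapositive of the stability of bounded invertibility).
[cite: TrefethenEmbree2005, Thm. 2.1 (proof, (2.3) ⇒ (2.1)) and §4 (4.4) ⇒ (4.3)] -/
theorem mem_spectrum_or_lt_norm_resolvent_of_mem_spectrum_add {a e : A} {z : ℂ} {ε : ℝ}
    (he : ‖e‖ < ε) (hz : z ∈ spectrum ℂ (a + e)) :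
    z ∈ spectrum ℂ a ∨ ε⁻¹ < ‖resolvent a z‖ := by
  by_cases hza : z ∈ spectrum ℂ a
  · exact Or.inl hza
  refine Or.inr (lt_of_not_ge fun hle => ?_)
  have hρ : z ∈ resolventSet ℂ a :=
    spectrum.mem_resolventSet_iff.mpr (not_not.mp (spectrum.mem_iff.not.mp hza))
  have hε : 0 < ε := (norm_nonneg e).trans_lt he
  have hprod : ‖resolvent a z‖ * ‖e‖ < 1 :=
    calc ‖resolvent a z‖ * ‖e‖ ≤ ε⁻¹ * ‖e‖ := mul_le_mul_of_nonneg_right hle (norm_nonneg _)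
      _ < ε⁻¹ * ε := mul_lt_mul_of_pos_left he (inv_pos.mpr hε)
      _ = 1 := inv_mul_cancel₀ hε.ne'
  exact spectrum.mem_iff.mp hz
    (spectrum.mem_resolventSet_iff.mp (resolventSet_add_of_norm_resolvent_mul_norm_lt hρ hprod))

/-- **The resolvent norm dominates the reciprocal distance to the spectrum**, pointwise form:
for `z ∈ ρ(a)` and `w ∈ σ(a)`, `1 ≤ ‖(z - a)⁻¹‖ · |z - w|`.
[cite: TrefethenEmbree2005, §4 p. 33 (consequence of Thm. 4.1)] -/
theorem one_le_norm_resolvent_mul_norm_sub {a : A} {z w : ℂ} (hz : z ∈ resolventSet ℂ a)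
    (hw : w ∈ spectrum ℂ a) : 1 ≤ ‖resolvent a z‖ * ‖z - w‖ :=
  le_of_not_gt fun h => spectrum.mem_iff.mp hw
    (spectrum.mem_resolventSet_iff.mp (resolventSet_of_norm_resolvent_mul_norm_sub_lt hz h))

/-- **`‖(z - a)⁻¹‖ ≥ 1 / dist(z, σ(a))`** for `z ∈ ρ(a)` and nonempty spectrum.
[cite: TrefethenEmbree2005, §4 p. 33 and Thm. 4.2] -/
theorem inv_infDist_le_norm_resolvent {a : A} {z : ℂ} (hz : z ∈ resolventSet ℂ a)
    (hne : (spectrum ℂ a).Nonempty) :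
    (Metric.infDist z (spectrum ℂ a))⁻¹ ≤ ‖resolvent a z‖ := by
  have hR : 0 < ‖resolvent a z‖ := by
    obtain ⟨w, hw⟩ := hne
    have h1 := one_le_norm_resolvent_mul_norm_sub hz hw
    rcases (norm_nonneg (resolvent a z)).eq_or_lt with h0 | h0
    · rw [← h0, zero_mul] at h1
      exact absurd h1 (by norm_num)
    · exact h0
  have hle : ‖resolvent a z‖⁻¹ ≤ Metric.infDist z (spectrum ℂ a) := by
    refine (Metric.le_infDist hne).mpr fun w hw => ?_
    rw [dist_eq_norm, inv_le_iff_one_le_mul₀ hR, mul_comm]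
    exact one_le_norm_resolvent_mul_norm_sub hz hw
  calc (Metric.infDist z (spectrum ℂ a))⁻¹ ≤ (‖resolvent a z‖⁻¹)⁻¹ :=
        inv_anti₀ (inv_pos.mpr hR) hle
    _ = ‖resolvent a z‖ := inv_inv _

end BanachAlgebra

section Operator

variable {X : Type*} [NormedAddCommGroup X] [NormedSpace ℂ X]

/-- **First definition (4.3) / (2.1)**: the `ε`-pseudospectrum of the bounded operator `T` is the
set of `z` with `‖(z - T)⁻¹‖ > ε⁻¹`, the resolvent norm being read as `∞` on `σ(T)` — i.e.
`z ∈ σ(T)` or `ε⁻¹ < ‖resolvent T z‖`. [cite: TrefethenEmbree2005, §4 (4.3) and §2 (2.1)] -/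
def pseudospectrum (T : X →L[ℂ] X) (ε : ℝ) : Set ℂ :=
  {z | z ∈ spectrum ℂ T ∨ ε⁻¹ < ‖resolvent T z‖}

/-- **Second definition (4.4) / (2.3)**: the set of spectral values of the perturbed operators
`T + E`, `E` bounded with `‖E‖ < ε`. [cite: TrefethenEmbree2005, §4 (4.4) and §2 (2.3)] -/
def perturbedSpectra (T : X →L[ℂ] X) (ε : ℝ) : Set ℂ :=
  {z | ∃ E : X →L[ℂ] X, ‖E‖ < ε ∧ z ∈ spectrum ℂ (T + E)}

/-- **Third definition (4.5) / (2.6)**: `z ∈ σ(T)`, or `z` is an `ε`-pseudoeigenvalue — there is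
a nonzero `u` (an `ε`-pseudoeigenvector) with `‖z u - T u‖ < ε ‖u‖`.
[cite: TrefethenEmbree2005, §4 (4.5) and §2 (2.6)] -/
def pseudoeigenvalues (T : X →L[ℂ] X) (ε : ℝ) : Set ℂ :=
  {z | z ∈ spectrum ℂ T ∨ ∃ u : X, u ≠ 0 ∧ ‖z • u - T u‖ < ε * ‖u‖}

/-- Membership in `pseudospectrum` unfolded. [cite: TrefethenEmbree2005, §4 (4.3)] -/
theorem mem_pseudospectrum_iff {T : X →L[ℂ] X} {ε : ℝ} {z : ℂ} :
    z ∈ pseudospectrum T ε ↔ z ∈ spectrum ℂ T ∨ ε⁻¹ < ‖resolvent T z‖ := Iff.rfl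

/-- Membership in `perturbedSpectra` unfolded. [cite: TrefethenEmbree2005, §4 (4.4)] -/
theorem mem_perturbedSpectra_iff {T : X →L[ℂ] X} {ε : ℝ} {z : ℂ} :
    z ∈ perturbedSpectra T ε ↔ ∃ E : X →L[ℂ] X, ‖E‖ < ε ∧ z ∈ spectrum ℂ (T + E) := Iff.rfl

/-- Membership in `pseudoeigenvalues` unfolded. [cite: TrefethenEmbree2005, §4 (4.5)] -/
theorem mem_pseudoeigenvalues_iff {T : X →L[ℂ] X} {ε : ℝ} {z : ℂ} :
    z ∈ pseudoeigenvalues T ε ↔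
      z ∈ spectrum ℂ T ∨ ∃ u : X, u ≠ 0 ∧ ‖z • u - T u‖ < ε * ‖u‖ := Iff.rfl

/-- The operator `z - T` of the book is Mathlib's `algebraMap ℂ _ z - T`; applied to a vector it is
`z u - T u`. [cite: TrefethenEmbree2005, §4 p. 32] -/
theorem algebraMap_sub_apply (T : X →L[ℂ] X) (z : ℂ) (u : X) :
    (algebraMap ℂ (X →L[ℂ] X) z - T) u = z • u - T u := by
  simp [Algebra.algebraMap_eq_smul_one]

/-- The scalar operator `d · 1` has norm at most `|d|` (equality unless `X = 0`).
[cite: TrefethenEmbree2005, Thm. 2.2 (proof: the norm of `δ I` is `|δ|`)] -/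
theorem norm_algebraMap_le (d : ℂ) : ‖algebraMap ℂ (X →L[ℂ] X) d‖ ≤ ‖d‖ := by
  rw [Algebra.algebraMap_eq_smul_one, norm_smul]
  refine mul_le_of_le_one_right (norm_nonneg _) ?_
  rw [ContinuousLinearMap.one_def]
  exact ContinuousLinearMap.norm_id_le

/-- **The spectrum lies in every pseudospectrum** (Theorem 4.3: "supersets of the spectrum").
[cite: TrefethenEmbree2005, Thm. 4.3 and (2.5)] -/
theorem spectrum_subset_pseudospectrum (T : X →L[ℂ] X) (ε : ℝ) :
    spectrum ℂ T ⊆ pseudospectrum T ε :=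
  fun _ hz => Or.inl hz

/-- **Nesting (2.4)**: `σ_{ε₁}(T) ⊆ σ_{ε₂}(T)` for `0 < ε₁ ≤ ε₂`.
[cite: TrefethenEmbree2005, (2.4) and Thm. 4.3] -/
theorem pseudospectrum_mono (T : X →L[ℂ] X) {ε₁ ε₂ : ℝ} (hε₁ : 0 < ε₁) (h : ε₁ ≤ ε₂) :
    pseudospectrum T ε₁ ⊆ pseudospectrum T ε₂ := by
  rintro z (hz | hz)
  · exact Or.inl hz
  · exact Or.inr ((inv_anti₀ hε₁ h).trans_lt hz)

/-- **(2.5)**, pointwise: `z ∈ σ(T)` iff `z` lies in every `σ_ε(T)`, `ε > 0` (if `z ∈ ρ(T)` then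
`z ∉ σ_ε(T)` for `ε = (‖(z - T)⁻¹‖ + 1)⁻¹`). [cite: TrefethenEmbree2005, (2.5) and Thm. 4.3] -/
theorem mem_spectrum_iff_forall_mem_pseudospectrum (T : X →L[ℂ] X) {z : ℂ} :
    z ∈ spectrum ℂ T ↔ ∀ ε : ℝ, 0 < ε → z ∈ pseudospectrum T ε := by
  refine ⟨fun hz ε _ => Or.inl hz, fun h => ?_⟩
  by_contra hz
  rcases h (‖resolvent T z‖ + 1)⁻¹ (by positivity) with h' | h'
  · exact hz h'
  · rw [inv_inv] at h'
    linarith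

/-- **(2.5)**: `⋂_{ε > 0} σ_ε(T) = σ(T)`. [cite: TrefethenEmbree2005, (2.5) and Thm. 4.3] -/
theorem iInter_pseudospectrum_eq_spectrum (T : X →L[ℂ] X) :
    ⋂ ε ∈ Set.Ioi (0 : ℝ), pseudospectrum T ε = spectrum ℂ T := by
  ext z
  simp only [Set.mem_iInter, Set.mem_Ioi]
  exact (mem_spectrum_iff_forall_mem_pseudospectrum T).symm

/-- **(4.3) ⊆ (4.5)**: if `‖(z - T)⁻¹‖ > ε⁻¹`, some `x` has `‖(z - T)⁻¹ x‖ > ε⁻¹ ‖x‖`, and then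
`u = (z - T)⁻¹ x ≠ 0` is an `ε`-pseudoeigenvector: `‖(z - T) u‖ = ‖x‖ < ε ‖u‖`.
[cite: TrefethenEmbree2005, Thm. 2.1 ((2.1) ⇒ (2.6)) and Thm. 4.3] -/
theorem pseudospectrum_subset_pseudoeigenvalues (T : X →L[ℂ] X) {ε : ℝ} (hε : 0 < ε) :
    pseudospectrum T ε ⊆ pseudoeigenvalues T ε := by
  rintro z (hz | hz)
  · exact Or.inl hz
  by_cases hzσ : z ∈ spectrum ℂ T
  · exact Or.inl hzσ
  right
  have hunit : IsUnit (algebraMap ℂ (X →L[ℂ] X) z - T) :=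
    not_not.mp (spectrum.mem_iff.not.mp hzσ)
  obtain ⟨u, hu⟩ := hunit
  have hres : resolvent T z = (↑u⁻¹ : X →L[ℂ] X) := resolvent_eq_units_inv hu
  obtain ⟨x, hx⟩ : ∃ x : X, ε⁻¹ * ‖x‖ < ‖(↑u⁻¹ : X →L[ℂ] X) x‖ := by
    by_contra hcon
    simp only [not_exists, not_lt] at hcon
    have hle : ‖(↑u⁻¹ : X →L[ℂ] X)‖ ≤ ε⁻¹ :=
      ContinuousLinearMap.opNorm_le_bound _ (inv_nonneg.mpr hε.le) hcon
    rw [← hres] at hle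
    exact absurd hz (not_lt.mpr hle)
  refine ⟨(↑u⁻¹ : X →L[ℂ] X) x, ?_, ?_⟩
  · intro h0
    rw [h0, norm_zero] at hx
    exact absurd hx (not_lt.mpr (mul_nonneg (inv_nonneg.mpr hε.le) (norm_nonneg _)))
  · have hid : (algebraMap ℂ (X →L[ℂ] X) z - T) ((↑u⁻¹ : X →L[ℂ] X) x) = x := by
      have h := DFunLike.congr_fun (Units.mul_inv u) x
      rw [hu] at h
      simpa using h
    rw [← algebraMap_sub_apply, hid]
    have := mul_lt_mul_of_pos_left hx hε
    rwa [← mul_assoc, mul_inv_cancel₀ hε.ne', one_mul] at this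

/-- Shifting a witness: if `z ∈ σ(T + E)` and `‖E‖ + |d| < ε` then `z + d ∈ σ(T + (E + d · 1))`
with `‖E + d · 1‖ < ε`, so `z + d` lies in the perturbation set (4.4) at level `ε`.
[cite: TrefethenEmbree2005, Thm. 2.2 (proof of (2.16)) and Thm. 4.3] -/
theorem add_mem_perturbedSpectra {T : X →L[ℂ] X} {ε : ℝ} {z : ℂ} (E : X →L[ℂ] X)
    (hz : z ∈ spectrum ℂ (T + E)) (d : ℂ) (h : ‖E‖ + ‖d‖ < ε) :
    z + d ∈ perturbedSpectra T ε := by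
  rw [mem_perturbedSpectra_iff]
  refine ⟨E + algebraMap ℂ (X →L[ℂ] X) d, ?_, ?_⟩
  · calc ‖E + algebraMap ℂ (X →L[ℂ] X) d‖ ≤ ‖E‖ + ‖algebraMap ℂ (X →L[ℂ] X) d‖ := norm_add_le _ _
      _ ≤ ‖E‖ + ‖d‖ := by gcongr; exact norm_algebraMap_le d
      _ < ε := h
  · rw [← add_assoc]
    exact add_mem_spectrum_add_algebraMap hz d

/-- **Openness** of the perturbation set (4.4) (Theorem 4.3: each `σ_ε` is open): around a point
witnessed by `E` there is room `ε - ‖E‖` for scalar shifts. [cite: TrefethenEmbree2005, Thm. 4.3] -/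
theorem isOpen_perturbedSpectra (T : X →L[ℂ] X) (ε : ℝ) : IsOpen (perturbedSpectra T ε) := by
  rw [Metric.isOpen_iff]
  rintro z ⟨E, hE, hz⟩
  refine ⟨ε - ‖E‖, sub_pos.mpr hE, fun z' hz' => ?_⟩
  rw [Metric.mem_ball, dist_eq_norm] at hz'
  have := add_mem_perturbedSpectra (ε := ε) E hz (z' - z) (by linarith)
  rwa [add_sub_cancel] at this

variable [CompleteSpace X]

/-- **(4.4) ⊆ (4.3)**: a spectral value of some `T + E` with `‖E‖ < ε` lies in the
`ε`-pseudospectrum (Theorem 4.1).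
[cite: TrefethenEmbree2005, Thm. 2.1 ((2.3) ⇒ (2.1)) and Thm. 4.3] -/
theorem perturbedSpectra_subset_pseudospectrum (T : X →L[ℂ] X) (ε : ℝ) :
    perturbedSpectra T ε ⊆ pseudospectrum T ε :=
  fun _ ⟨_, hE, hz⟩ => mem_spectrum_or_lt_norm_resolvent_of_mem_spectrum_add hE hz

/-- **(4.5) ⊆ (4.4)** — the rank-one perturbation: for `u ≠ 0` with `‖z u - T u‖ < ε ‖u‖` pick a
Hahn–Banach functional `g` with `‖g‖ = 1`, `g u = ‖u‖`, and put `E x = g x · (g u)⁻¹ (z u - T u)`;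
then `‖E‖ = ‖z u - T u‖ / ‖u‖ < ε` and `(T + E) u = z u`, so `z - (T + E)` is not injective, hence
not invertible. (For `z ∈ σ(T)` take `E = 0`.)
[cite: TrefethenEmbree2005, Thm. 2.1 ((2.6) ⇒ (2.3), footnote 3) and Thm. 4.3] -/
theorem pseudoeigenvalues_subset_perturbedSpectra (T : X →L[ℂ] X) {ε : ℝ} (hε : 0 < ε) :
    pseudoeigenvalues T ε ⊆ perturbedSpectra T ε := by
  rintro z (hz | ⟨u, hu, hlt⟩)
  · exact ⟨0, by simpa using hε, by simpa using hz⟩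
  have hnorm : ‖u‖ ≠ 0 := norm_ne_zero_iff.mpr hu
  obtain ⟨g, hg1, hgu⟩ := exists_dual_vector ℂ u hnorm
  have hgu' : ‖g u‖ = ‖u‖ := by
    rw [hgu]
    simp
  have hgu0 : g u ≠ 0 := norm_ne_zero_iff.mp (by rw [hgu']; exact hnorm)
  let E : X →L[ℂ] X := g.smulRight ((g u)⁻¹ • (z • u - T u))
  have hEu : E u = z • u - T u := by
    simp only [E, ContinuousLinearMap.smulRight_apply, smul_smul]
    rw [mul_inv_cancel₀ hgu0, one_smul]
  have hEnorm : ‖E‖ < ε := by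
    have h1 : ‖E‖ = ‖u‖⁻¹ * ‖z • u - T u‖ := by
      simp only [E]
      rw [ContinuousLinearMap.norm_smulRight_apply, hg1, one_mul, norm_smul, norm_inv, hgu']
    rw [h1, inv_mul_lt_iff₀ (norm_pos_iff.mpr hu), mul_comm]
    exact hlt
  refine ⟨E, hEnorm, ?_⟩
  rw [spectrum.mem_iff]
  intro hunit
  have hinj := (ContinuousLinearMap.isUnit_iff_bijective.mp hunit).1
  have h0 : (algebraMap ℂ (X →L[ℂ] X) z - (T + E)) u = 0 := by
    rw [sub_add_eq_sub_sub, sub_apply, algebraMap_sub_apply, hEu, sub_self]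
  exact hu (hinj (h0.trans (map_zero _).symm))

/-- **Theorem 2.1 / Theorem 4.3 (first clause)**: for `ε > 0` the resolvent-norm definition (4.3)
and the perturbation definition (4.4) of the `ε`-pseudospectrum agree.
[cite: TrefethenEmbree2005, Thm. 2.1 and Thm. 4.3] -/
theorem pseudospectrum_eq_perturbedSpectra (T : X →L[ℂ] X) {ε : ℝ} (hε : 0 < ε) :
    pseudospectrum T ε = perturbedSpectra T ε :=
  Set.Subset.antisymm
    ((pseudospectrum_subset_pseudoeigenvalues T hε).trans
      (pseudoeigenvalues_subset_perturbedSpectra T hε))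
    (perturbedSpectra_subset_pseudospectrum T ε)

/-- **Theorem 2.1 / Theorem 4.3 (first clause)**: for `ε > 0` the resolvent-norm definition (4.3)
and the pseudoeigenvalue definition (4.5) agree.
[cite: TrefethenEmbree2005, Thm. 2.1 and Thm. 4.3] -/
theorem pseudospectrum_eq_pseudoeigenvalues (T : X →L[ℂ] X) {ε : ℝ} (hε : 0 < ε) :
    pseudospectrum T ε = pseudoeigenvalues T ε :=
  Set.Subset.antisymm (pseudospectrum_subset_pseudoeigenvalues T hε)
    ((pseudoeigenvalues_subset_perturbedSpectra T hε).trans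
      (perturbedSpectra_subset_pseudospectrum T ε))

/-- **Theorem 2.1 / Theorem 4.3 (first clause)**: for `ε > 0` the perturbation definition (4.4) and
the pseudoeigenvalue definition (4.5) agree. [cite: TrefethenEmbree2005, Thm. 2.1 and Thm. 4.3] -/
theorem perturbedSpectra_eq_pseudoeigenvalues (T : X →L[ℂ] X) {ε : ℝ} (hε : 0 < ε) :
    perturbedSpectra T ε = pseudoeigenvalues T ε := by
  rw [← pseudospectrum_eq_perturbedSpectra T hε, pseudospectrum_eq_pseudoeigenvalues T hε]

/-- Pointwise form of Theorem 2.1: `z ∈ σ_ε(T)` iff `z ∈ σ(T + E)` for some `‖E‖ < ε`.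
[cite: TrefethenEmbree2005, Thm. 2.1 and §4 (4.3)–(4.4)] -/
theorem mem_pseudospectrum_iff_exists_perturbation (T : X →L[ℂ] X) {ε : ℝ} (hε : 0 < ε) {z : ℂ} :
    z ∈ pseudospectrum T ε ↔ ∃ E : X →L[ℂ] X, ‖E‖ < ε ∧ z ∈ spectrum ℂ (T + E) := by
  rw [pseudospectrum_eq_perturbedSpectra T hε, mem_perturbedSpectra_iff]

/-- Pointwise form of Theorem 2.1: `z ∈ σ_ε(T)` iff `z ∈ σ(T)` or `z` has an
`ε`-pseudoeigenvector. [cite: TrefethenEmbree2005, Thm. 2.1 and §4 (4.3), (4.5)] -/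
theorem mem_pseudospectrum_iff_mem_spectrum_or_exists_pseudoeigenvector (T : X →L[ℂ] X) {ε : ℝ}
    (hε : 0 < ε) {z : ℂ} :
    z ∈ pseudospectrum T ε ↔ z ∈ spectrum ℂ T ∨ ∃ u : X, u ≠ 0 ∧ ‖z • u - T u‖ < ε * ‖u‖ := by
  rw [pseudospectrum_eq_pseudoeigenvalues T hε, mem_pseudoeigenvalues_iff]

/-- **Theorem 4.3**: `σ_ε(T)` is open (`ε > 0`). [cite: TrefethenEmbree2005, Thm. 4.3] -/
theorem isOpen_pseudospectrum (T : X →L[ℂ] X) {ε : ℝ} (hε : 0 < ε) :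
    IsOpen (pseudospectrum T ε) := by
  rw [pseudospectrum_eq_perturbedSpectra T hε]
  exact isOpen_perturbedSpectra T ε

/-- **(2.16)**: `σ(T) + Δ_ε ⊆ σ_ε(T)` (the perturbation `E = δ · 1`).
[cite: TrefethenEmbree2005, Thm. 2.2 (2.16) and Thm. 4.3] -/
theorem spectrum_add_ball_subset_pseudospectrum (T : X →L[ℂ] X) {ε : ℝ} (hε : 0 < ε) :
    spectrum ℂ T + Metric.ball (0 : ℂ) ε ⊆ pseudospectrum T ε := by
  rw [pseudospectrum_eq_perturbedSpectra T hε]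
  rintro _ ⟨z, hz, d, hd, rfl⟩
  rw [Metric.mem_ball, dist_zero_right] at hd
  exact add_mem_perturbedSpectra 0 (by simpa using hz) d (by simpa using hd)

/-- **Theorem 4.3 (last clause)**: `σ_ε(T) + Δ_δ ⊆ σ_{ε+δ}(T)` for `ε, δ > 0`.
[cite: TrefethenEmbree2005, Thm. 4.3] -/
theorem pseudospectrum_add_ball_subset (T : X →L[ℂ] X) {ε δ : ℝ} (hε : 0 < ε) (hδ : 0 < δ) :
    pseudospectrum T ε + Metric.ball (0 : ℂ) δ ⊆ pseudospectrum T (ε + δ) := by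
  rw [pseudospectrum_eq_perturbedSpectra T hε, pseudospectrum_eq_perturbedSpectra T (by positivity)]
  rintro _ ⟨z, ⟨E, hE, hz⟩, d, hd, rfl⟩
  rw [Metric.mem_ball, dist_zero_right] at hd
  exact add_mem_perturbedSpectra E hz d (by linarith)

/-- **Theorem 4.3**: each pseudospectrum is nonempty (on a nonzero space), since the spectrum of a
bounded operator on a complex Banach space is nonempty. [cite: TrefethenEmbree2005, Thm. 4.3] -/
theorem pseudospectrum_nonempty [Nontrivial X] (T : X →L[ℂ] X) (ε : ℝ) :
    (pseudospectrum T ε).Nonempty :=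
  (spectrum.nonempty T).mono (spectrum_subset_pseudospectrum T ε)

/-- **A point at distance `< ε` from `σ(T)` lies in `σ_ε(T)`** — the pointwise form of (2.16),
via `‖(z - T)⁻¹‖ ≥ 1 / dist(z, σ(T)) > ε⁻¹`. (The converse fails in general: pseudospectra of
non-normal operators can be much larger than the `ε`-neighbourhood of the spectrum, §2 p. 19.)
[cite: TrefethenEmbree2005, Thm. 2.2 (2.16) and §4 p. 33] -/
theorem mem_pseudospectrum_of_infDist_lt (T : X →L[ℂ] X) {ε : ℝ} {z : ℂ}
    (hne : (spectrum ℂ T).Nonempty) (hz : Metric.infDist z (spectrum ℂ T) < ε) :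
    z ∈ pseudospectrum T ε := by
  by_cases hzσ : z ∈ spectrum ℂ T
  · exact Or.inl hzσ
  have hρ : z ∈ resolventSet ℂ T :=
    spectrum.mem_resolventSet_iff.mpr (not_not.mp (spectrum.mem_iff.not.mp hzσ))
  have hpos : 0 < Metric.infDist z (spectrum ℂ T) := by
    have hcl : IsClosed (spectrum ℂ T) := spectrum.isClosed T
    exact (hcl.notMem_iff_infDist_pos hne).mp hzσ
  exact Or.inr ((inv_strictAnti₀ hpos hz).trans_le (inv_infDist_le_norm_resolvent hρ hne))

/-- **Finite dimension: a spectral value is an eigenvalue**, so it has an exact eigenvector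
`u ≠ 0`, `z u - T u = 0` (injective endomorphisms of a finite-dimensional space are bijective, and
bijective bounded operators are units).
[cite: TrefethenEmbree2005, Thm. 2.1 (the case `z ∈ σ(A)`)] -/
theorem exists_eigenvector_of_mem_spectrum [FiniteDimensional ℂ X] {T : X →L[ℂ] X} {z : ℂ}
    (hz : z ∈ spectrum ℂ T) : ∃ u : X, u ≠ 0 ∧ z • u - T u = 0 := by
  by_contra h
  simp only [not_exists, not_and] at h
  apply spectrum.mem_iff.mp hz
  rw [ContinuousLinearMap.isUnit_iff_bijective]
  have hinj : Function.Injective (algebraMap ℂ (X →L[ℂ] X) z - T) := by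
    rw [injective_iff_map_eq_zero]
    intro u hu
    by_contra hne
    exact h u hne (by rwa [algebraMap_sub_apply] at hu)
  refine ⟨hinj, ?_⟩
  have hsurj : Function.Surjective
      ((algebraMap ℂ (X →L[ℂ] X) z - T : X →L[ℂ] X) : X →ₗ[ℂ] X) :=
    LinearMap.injective_iff_surjective.mp hinj
  exact hsurj

/-- **Theorem 2.1 with the matrix definition (2.6)**: in finite dimension, for `ε > 0`,
`z ∈ σ_ε(T)` iff `‖z u - T u‖ < ε ‖u‖` for some `u ≠ 0` (the clause `z ∈ σ(T)` of (4.5) is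
absorbed). [cite: TrefethenEmbree2005, Thm. 2.1 and (2.6)] -/
theorem mem_pseudospectrum_iff_exists_pseudoeigenvector [FiniteDimensional ℂ X] (T : X →L[ℂ] X)
    {ε : ℝ} (hε : 0 < ε) {z : ℂ} :
    z ∈ pseudospectrum T ε ↔ ∃ u : X, u ≠ 0 ∧ ‖z • u - T u‖ < ε * ‖u‖ := by
  rw [pseudospectrum_eq_pseudoeigenvalues T hε]
  refine ⟨?_, fun h => Or.inr h⟩
  rintro (hz | h)
  · obtain ⟨u, hu, h0⟩ := exists_eigenvector_of_mem_spectrum hz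
    exact ⟨u, hu, by rw [h0, norm_zero]; exact mul_pos hε (norm_pos_iff.mpr hu)⟩
  · exact h

end Operator

end Literature.Analysis.OperatorTheory.Pseudospectra

end
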